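import Summits.RiemannHypothesis.RiemannHypothesis.Theorems.JensenPolynomialsFarGumbelShift
import Summits.RiemannHypothesis.RiemannHypothesis.Theorems.JensenPolynomialsFarGumbelPhase
import Summits.RiemannHypothesis.RiemannHypothesis.Theorems.JensenPolynomialsLaplaceLineLinear
import Summits.RiemannHypothesis.RiemannHypothesis.Theorems.JensenPolynomialsLaplaceLogAssembly

/-!
# Route `JensenPolynomials`, FAR crux `XiWindowZeroFreeRelFar` (B1-rel far) — S3 step 3: the MASTER ASSEMBLY — `winJ ≠ 0`
and `log‖winJ‖` from pointwise data along the saddle line (RH-FREE; cell rh-jensen, HUMAN RULING D-0040)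

Stub S3 `stub_laplaceFar` (theory g8's line «far-gumbel» v4, S3-BLUEPRINT §1–§4, item `stmt-RiemannHypothesis-19465`) is here
REDUCED, kernel-checked, to a finite list of POINTWISE statements about the explicit far phase `Ψ = farPsi M a`
(`JensenPolynomialsFarGumbelPhase`) along ONE horizontal line `Im u = y_s` (`|y_s| ≤ 1/10`) and at ONE point `u_s = x_s + iy_s`:

* (W) a drifted cubic window `‖Ψ(x+iy_s) − Ψ(u_s) − b(x−x_s) + c(x−x_s)²‖ ≤ M_c|x−x_s|³` (`|x−x_s| ≤ δ`, `Re c > 0`, `M_cδ ≤ Re c/4`);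
* (Q) the kernel is its head up to `η`: `‖Φ_C(u)/Φ₁(u) − 1‖ ≤ η` on the line, `Φ₁(u) = 2π²e^{9u}e^{−πe^{4u}}`;
* (D) descent: `Re(Ψ(x+iy_s) − Ψ(u_s)) ≤ −A` left of the window (down to `υ − 2`) and `≤ −A − (x − x_s − δ)` right of it;
* (C) a bound `E_conn` for the vertical connector integral at `Re u = υ − 2`;
* (θ) the resulting total error is at most `θ·|main term|`, `θ ≤ 1/2`.

THEN (`laplaceFar_of_pointwise`): `winJ M υ a ≠ 0` and
`|log‖winJ M υ a‖ − (Re(Ψ(u_s) + b²/(4c)) + ½(log π − log‖c‖))| ≤ 2θ`.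
The tools: the contour shift `FarGumbel.winJ_integrand_eq_shift` (p446215), the factorisation `FarGumbel.exp_farPsi` (p446772),
the line assembly with drift `WindowEGF.norm_integral_line_lin_sub_main_le` (p447844) and `WindowEGF.laplace_log_of_rel_approx`
(p447360). What remains for S3 after this file: the pointwise inequalities (W) (via `WindowEGF.cubic_window_of_hasDerivAt` from
`|Ψ‴| ≤ K`), (D), (Q) (eng-5 g3's `DeBruijnPhiComplexHead`), (C), the existence of the saddle (`WindowEGF.exists_zero_near_of_hasDerivAt`)
and the comparison of `Re Ψ(u_s) + ½log(π/‖c‖)` with `farMain` (S3-BLUEPRINT §4 ledger).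
WHAT THIS IS NOT: bookkeeping; nothing here bears on the zeros of `ζ` or the truth of RH.
-/

noncomputable section
-- D-0017: `Summit.RiemannHypothesis.RiemannHypothesis.…` duplicates the namespace BY DESIGN (single-problem summit).
set_option linter.dupNamespace false

namespace Summit.RiemannHypothesis.RiemannHypothesis.Theorems.JensenPolynomials.FarGumbel

open Literature.NumberTheory.LFunctions MeasureTheory Set Filter Complex
open Summit.RiemannHypothesis.RiemannHypothesis.Theorems.JensenPolynomials.WindowEGF
open scoped Real

/-- The HEAD of the kernel, `Φ₁(u) = 2π²e^{9u}e^{−πe^{4u}}` (entire, zero-free). -/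
def phiHead (u : ℂ) : ℂ := 2 * (π : ℂ) ^ 2 * Complex.exp (9 * u) * Complex.exp (-((π : ℂ) * Complex.exp (4 * u)))

/-- `Φ₁(u) ≠ 0`. -/
theorem phiHead_ne_zero (u : ℂ) : phiHead u ≠ 0 := by
  unfold phiHead
  have hπ : (π : ℂ) ≠ 0 := by exact_mod_cast Real.pi_ne_zero
  exact mul_ne_zero (mul_ne_zero (mul_ne_zero two_ne_zero (pow_ne_zero 2 hπ)) (Complex.exp_ne_zero _))
    (Complex.exp_ne_zero _)

/-- On the contour the integrand factorises through the phase: `Φ_C(u)·u·(u²+a)^{M−½} = e^{Ψ(u)}·(Φ_C(u)/Φ₁(u))`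
(`u ≠ 0`, `u² + a ≠ 0`). -/
theorem integrand_eq_exp_farPsi_mul (M : ℕ) (a : ℂ) {u : ℂ} (hu0 : u ≠ 0) (hs0 : u ^ 2 + a ≠ 0) :
    deBruijnPhiC u * (u * (u ^ 2 + a) ^ ((M : ℂ) - 1 / 2)) =
      Complex.exp (farPsi M a u) * (deBruijnPhiC u / phiHead u) := by
  rw [exp_farPsi M a hu0 hs0]
  have h := phiHead_ne_zero u
  unfold phiHead at h ⊢
  field_simp

/-- **S3 MASTER ASSEMBLY (reduction of `stub_laplaceFar` to pointwise data).** See the module docstring for the list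
(W) (Q) (D) (C) (θ). Conclusion: `winJ M υ a ≠ 0` and
`|log‖winJ M υ a‖ − (Re(Ψ(u_s) + b²/(4c)) + ½(log π − log‖c‖))| ≤ 2θ`. -/
theorem laplaceFar_of_pointwise (M : ℕ) (hM : 1 ≤ M) {υ : ℝ} (hυ : (189 / 20 : ℝ) ≤ υ) {a : ℂ}
    (ha : ‖a‖ ≤ (9 / 25 : ℝ) * υ ^ 2) {x_s y_s δ Mc A η Econn θ : ℝ} {b c : ℂ}
    (hy : |y_s| ≤ 1 / 10) (hc : 0 < c.re) (hδ : 0 ≤ δ) (hxs : υ - 2 ≤ x_s - δ) (hMc : 0 ≤ Mc)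
    (hMcδ : Mc * δ ≤ c.re / 4) (hη : 0 ≤ η) (hθ0 : 0 ≤ θ) (hθ : θ ≤ 1 / 2)
    (hT : ∀ x : ℝ, |x - x_s| ≤ δ →
      ‖farPsi M a (x + y_s * I) - farPsi M a (x_s + y_s * I) - b * (x - x_s) + c * (x - x_s) ^ 2‖ ≤ Mc * |x - x_s| ^ 3)
    (hQ : ∀ x : ℝ, υ - 2 ≤ x → ‖deBruijnPhiC (x + y_s * I) / phiHead (x + y_s * I) - 1‖ ≤ η)
    (hL : ∀ x ∈ Ioc (υ - 2) (x_s - δ), (farPsi M a (x + y_s * I) - farPsi M a (x_s + y_s * I)).re ≤ -A)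
    (hR : ∀ x ∈ Ioi (x_s + δ), (farPsi M a (x + y_s * I) - farPsi M a (x_s + y_s * I)).re ≤ -A - (x - (x_s + δ)))
    (hconn : ‖∫ t in (0 : ℝ)..y_s, deBruijnPhiC ((υ - 2 : ℝ) + t * I) *
        ((((υ - 2 : ℝ) : ℂ) + t * I) * ((((υ - 2 : ℝ) : ℂ) + t * I) ^ 2 + a) ^ ((M : ℂ) - 1 / 2))‖ ≤ Econn)
    (hbudget : Real.exp (farPsi M a (x_s + y_s * I)).re *
          (Real.exp (‖b‖ ^ 2 / c.re) * (4 * Mc / c.re ^ 2 + Real.exp (-(c.re * δ ^ 2 / 4)) * Real.sqrt (2 * π / c.re) +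
            η * Real.sqrt (2 * π / c.re)) + (1 + η) * Real.exp (-A) * (x_s - δ - (υ - 2) + 1)) + Econn ≤
        θ * (Real.exp (farPsi M a (x_s + y_s * I) + b ^ 2 / (4 * c)).re * (π / ‖c‖) ^ (1 / 2 : ℝ))) :
    winJ M υ a ≠ 0 ∧
      |Real.log ‖winJ M υ a‖ -
          ((farPsi M a (x_s + y_s * I) + b ^ 2 / (4 * c)).re + 1 / 2 * (Real.log π - Real.log ‖c‖))| ≤ 2 * θ := by
  have hc0 : c ≠ 0 := fun h => by rw [h, Complex.zero_re] at hc; exact lt_irrefl _ hc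
  have ha0 : 0 < υ - 2 := by linarith
  -- (1) the contour shift: `winJ = ray + I·connector`
  obtain ⟨-, hint1, hshift⟩ := winJ_integrand_eq_shift M hM hυ ha hy
  have hJ : winJ M υ a =
      (∫ x in Ioi (υ - 2), deBruijnPhiC (x + y_s * I) *
          (((x : ℂ) + y_s * I) * (((x : ℂ) + y_s * I) ^ 2 + a) ^ ((M : ℂ) - 1 / 2))) +
        I * ∫ t in (0 : ℝ)..y_s, deBruijnPhiC ((υ - 2 : ℝ) + t * I) *
          ((((υ - 2 : ℝ) : ℂ) + t * I) * ((((υ - 2 : ℝ) : ℂ) + t * I) ^ 2 + a) ^ ((M : ℂ) - 1 / 2)) := by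
    rw [winJ]; exact hshift
  -- geometry of the line: for `x ≥ υ − 2`, `u = x + iy_s` has `u ≠ 0` and `u² + a ≠ 0`
  have hline : ∀ x : ℝ, υ - 2 ≤ x → ((x : ℂ) + y_s * I) ≠ 0 ∧ ((x : ℂ) + y_s * I) ^ 2 + a ≠ 0 ∧
      0 < ((x : ℂ) + y_s * I).re ∧ ((x : ℂ) + y_s * I) ^ 2 + a ∈ slitPlane := by
    intro x hx
    have hre : ((x : ℂ) + y_s * I).re = x := by simp
    have hxpos : 0 < x := by linarith
    have hslit := sq_add_mem_slitPlane hυ ha hx hy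
    refine ⟨fun h => ?_, fun h => Complex.zero_notMem_slitPlane (h ▸ hslit), by rw [hre]; exact hxpos, hslit⟩
    have := congrArg Complex.re h
    rw [hre, Complex.zero_re] at this
    linarith
  -- (2) the clamped phase `P̃ x = Ψ(max x (υ−2) + iy_s)` is continuous on `ℝ` and agrees with `Ψ` on the line
  set Pt : ℝ → ℂ := fun x => farPsi M a ((max x (υ - 2) : ℝ) + y_s * I) with hPt
  have hPt_eq : ∀ x : ℝ, υ - 2 ≤ x → Pt x = farPsi M a (x + y_s * I) := by
    intro x hx; simp only [hPt, max_eq_left hx]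
  have hPcont : Continuous Pt := by
    have hc1 : ContinuousOn (fun x : ℝ => farPsi M a (x + y_s * I)) (Ici (υ - 2)) := by
      intro x hx
      obtain ⟨-, -, hre, hsl⟩ := hline x hx
      have hd := (hasDerivAt_farPsi M a hre hsl).continuousAt
      have h2 : ContinuousAt (fun x : ℝ => (x : ℂ) + y_s * I) x :=
        (by fun_prop : Continuous fun x : ℝ => (x : ℂ) + y_s * I).continuousAt
      exact (ContinuousAt.comp (g := farPsi M a) (f := fun x : ℝ => (x : ℂ) + y_s * I) hd h2).continuousWithinAt
    have hclamp : Continuous fun x : ℝ => max x (υ - 2) := by fun_prop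
    have hmaps : ∀ x : ℝ, max x (υ - 2) ∈ Ici (υ - 2) := fun x => Set.mem_Ici.2 (le_max_right _ _)
    exact hc1.comp_continuous hclamp hmaps
  set Q : ℝ → ℂ := fun x => deBruijnPhiC (x + y_s * I) / phiHead (x + y_s * I) with hQdef
  -- (3) the shifted ray integral is `∫ e^{P̃}·Q`
  have hray : (∫ x in Ioi (υ - 2), deBruijnPhiC (x + y_s * I) *
        (((x : ℂ) + y_s * I) * (((x : ℂ) + y_s * I) ^ 2 + a) ^ ((M : ℂ) - 1 / 2))) =
      ∫ x in Ioi (υ - 2), Complex.exp (Pt x) * Q x := by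
    refine setIntegral_congr_fun measurableSet_Ioi fun x hx => ?_
    obtain ⟨hu0, hs0, -, -⟩ := hline x (le_of_lt hx)
    rw [hPt_eq x (le_of_lt hx), integrand_eq_exp_farPsi_mul M a hu0 hs0]
  have hintPQ : IntegrableOn (fun x : ℝ => Complex.exp (Pt x) * Q x) (Ioi (υ - 2)) := by
    refine hint1.congr_fun (fun x hx => ?_) measurableSet_Ioi
    obtain ⟨hu0, hs0, -, -⟩ := hline x (le_of_lt hx)
    show deBruijnPhiC (x + y_s * I) * (((x : ℂ) + y_s * I) * (((x : ℂ) + y_s * I) ^ 2 + a) ^ ((M : ℂ) - 1 / 2)) =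
      Complex.exp (Pt x) * Q x
    rw [hPt_eq x (le_of_lt hx), integrand_eq_exp_farPsi_mul M a hu0 hs0]
  -- (4) the line estimate (window with drift + descent + amplitude)
  have hxs' : υ - 2 ≤ x_s := by linarith
  have hTt : ∀ x : ℝ, |x - x_s| ≤ δ → ‖Pt x - Pt x_s - b * (x - x_s) + c * (x - x_s) ^ 2‖ ≤ Mc * |x - x_s| ^ 3 := by
    intro x hx
    have hx' : υ - 2 ≤ x := by linarith [(abs_le.mp hx).1]
    rw [hPt_eq x hx', hPt_eq x_s hxs']; exact hT x hx
  have hLt : ∀ x ∈ Ioc (υ - 2) (x_s - δ), (Pt x - Pt x_s).re ≤ -A := by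
    intro x hx
    rw [hPt_eq x (le_of_lt hx.1), hPt_eq x_s hxs']; exact hL x hx
  have hRt : ∀ x ∈ Ioi (x_s + δ), (Pt x - Pt x_s).re ≤ -A - (x - (x_s + δ)) := by
    intro x hx
    have hx' : υ - 2 ≤ x := by
      have : x_s + δ < x := hx
      linarith
    rw [hPt_eq x hx', hPt_eq x_s hxs']; exact hR x hx
  have hmain := norm_integral_line_lin_sub_main_le (P := Pt) (Q := Q) hPcont hc hδ hxs hMc hMcδ hη hTt
    (fun x hx => hQ x hx) hLt hRt hintPQ
  rw [hPt_eq x_s hxs'] at hmain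
  -- (5) `‖winJ − main‖ ≤ E₁ + E_conn`
  set Ψs : ℂ := farPsi M a (x_s + y_s * I) with hΨs
  set main : ℂ := Complex.exp (Ψs + b ^ 2 / (4 * c)) * ((π : ℂ) / c) ^ (1 / 2 : ℂ) with hmaindef
  have hmain_eq : Complex.exp Ψs * (((π : ℂ) / c) ^ (1 / 2 : ℂ) * Complex.exp (b ^ 2 / (4 * c))) = main := by
    rw [hmaindef, Complex.exp_add]; ring
  have hnorm_main : ‖main‖ = Real.exp (Ψs + b ^ 2 / (4 * c)).re * (π / ‖c‖) ^ (1 / 2 : ℝ) := by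
    have hπc : (π : ℂ) / c ≠ 0 := div_ne_zero (by exact_mod_cast Real.pi_ne_zero) hc0
    rw [hmaindef, norm_mul, Complex.norm_exp, norm_cpow_of_ne_zero hπc]
    simp [abs_of_pos Real.pi_pos]
  rw [hmain_eq] at hmain
  have hdiff : ‖winJ M υ a - main‖ ≤ θ * ‖main‖ := by
    rw [hJ, hray]
    have hconn' : ‖I * ∫ t in (0 : ℝ)..y_s, deBruijnPhiC ((υ - 2 : ℝ) + t * I) *
        ((((υ - 2 : ℝ) : ℂ) + t * I) * ((((υ - 2 : ℝ) : ℂ) + t * I) ^ 2 + a) ^ ((M : ℂ) - 1 / 2))‖ ≤ Econn := by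
      rw [norm_mul, Complex.norm_I, one_mul]; exact hconn
    calc ‖(∫ x in Ioi (υ - 2), Complex.exp (Pt x) * Q x) +
          I * (∫ t in (0 : ℝ)..y_s, deBruijnPhiC ((υ - 2 : ℝ) + t * I) *
            ((((υ - 2 : ℝ) : ℂ) + t * I) * ((((υ - 2 : ℝ) : ℂ) + t * I) ^ 2 + a) ^ ((M : ℂ) - 1 / 2))) - main‖
        = ‖((∫ x in Ioi (υ - 2), Complex.exp (Pt x) * Q x) - main) +
          I * (∫ t in (0 : ℝ)..y_s, deBruijnPhiC ((υ - 2 : ℝ) + t * I) *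
            ((((υ - 2 : ℝ) : ℂ) + t * I) * ((((υ - 2 : ℝ) : ℂ) + t * I) ^ 2 + a) ^ ((M : ℂ) - 1 / 2)))‖ := by
          congr 1; ring
      _ ≤ _ := norm_add_le _ _
      _ ≤ _ := add_le_add hmain hconn'
      _ ≤ θ * ‖main‖ := by rw [hnorm_main]; exact hbudget
  -- (6) logs
  have hrel : ‖winJ M υ a - Complex.exp (Ψs + b ^ 2 / (4 * c)) * ((π : ℂ) / c) ^ (1 / 2 : ℂ)‖ ≤
      θ * ‖Complex.exp (Ψs + b ^ 2 / (4 * c)) * ((π : ℂ) / c) ^ (1 / 2 : ℂ)‖ := hdiff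
  exact laplace_log_of_rel_approx hc0 hθ0 hθ hrel

end Summit.RiemannHypothesis.RiemannHypothesis.Theorems.JensenPolynomials.FarGumbel

end
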